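import Summits.Schanuel.Schanuel.Theorems.ZilberEacFibreCurveZeros
import HarnessLib

/-!
# Logarithmic strips, VI: second-order growth of `p(z)` along a strip when `Re(lc(p)·i^d) = 0`

HONEST FRAMING.  Cell `pub-schanuel` (Zilber's Exponential-Algebraic Closedness, case ladder;
host summit Schanuel), seat 2, gen 18.  Companion of `tendsto_growth_eval_of_near_imag` (gen 17,
`Re(lc(p)·i^d) ≠ 0`).  For `p = aX^d + a₁X^{d-1} + …`, `d ≥ 2`, `Re(a·i^d) = 0`, put
`τ := Re(a·i^{d-1})`, `σ := Re(a₁·i^{d-1})`.  Along `z_k = x_k + iy_k` with `y_k → +∞`,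
`|x_k| ≤ A log y_k + B`: `Re p(z_k) = (dτx_k + σ)y_k^{d-1} + O((1 + x_k²)y_k^{d-2})` (second-order
Taylor expansion of `z^d` at `iy_k`; the top term `y^d Re(a i^d)` is ZERO), so `|dτx_k + σ| ≥ η > 0`
eventually gives `|Re p(z_k)|/log(2 + ‖p(z_k)‖) → ∞` (**`tendsto_growth_eval_of_strip`**) — the
escape hypothesis of THEOREM G in the coordinate `x₁ = p(z)`; used in `ZilberEacFibreCurveDegenerate`
with the zeros of `ZilberEacFibreCurveZerosEdge`.  NOT Schanuel's conjecture (neither used nor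
implied; EAC ⇏ SC); `EC(3,2)` stays OPEN; Mantova–Masser's question (PLMS 2024, §1 p. 5) stays OPEN.
-/

noncomputable section

open Filter Topology Metric Set Complex
open Literature.ModelTheory.Zilber
open Literature.Geometry.Symplectic.RotationBranch (norm_pow_sub_pow_le)

set_option linter.dupNamespace false

namespace Summit.Schanuel.Schanuel.Theorems

/-! ## Part A. Second-order Taylor estimate for powers -/

/-- **`‖a^{k+2} - b^{k+2} - (k+2) b^{k+1}(a - b)‖ ≤ (k+2)² M^k ‖a - b‖²`** for `‖a‖, ‖b‖ ≤ M`
(from `R_{n+1} = a R_n + n b^{n-1}(a - b)²`). [folklore] -/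
theorem norm_pow_sub_pow_sub_mul_le {a b : ℂ} {M : ℝ} (ha : ‖a‖ ≤ M) (hb : ‖b‖ ≤ M) (k : ℕ) :
    ‖a ^ (k + 2) - b ^ (k + 2) - ((k + 2 : ℕ) : ℂ) * b ^ (k + 1) * (a - b)‖ ≤
      ((k + 2 : ℕ) : ℝ) ^ 2 * M ^ k * ‖a - b‖ ^ 2 := by
  have hM : 0 ≤ M := (norm_nonneg a).trans ha
  induction k with
  | zero =>
    have e : a ^ (0 + 2) - b ^ (0 + 2) - ((0 + 2 : ℕ) : ℂ) * b ^ (0 + 1) * (a - b) = (a - b) ^ 2 := by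
      push_cast; ring
    rw [e, norm_pow]
    have : 0 ≤ ‖a - b‖ ^ 2 := by positivity
    push_cast
    nlinarith
  | succ n ih =>
    have e : a ^ (n + 1 + 2) - b ^ (n + 1 + 2) - ((n + 1 + 2 : ℕ) : ℂ) * b ^ (n + 1 + 1) * (a - b) =
        a * (a ^ (n + 2) - b ^ (n + 2) - ((n + 2 : ℕ) : ℂ) * b ^ (n + 1) * (a - b)) +
          ((n + 2 : ℕ) : ℂ) * b ^ (n + 1) * (a - b) ^ 2 := by
      push_cast; ring
    rw [e]
    have h1 : ‖a * (a ^ (n + 2) - b ^ (n + 2) - ((n + 2 : ℕ) : ℂ) * b ^ (n + 1) * (a - b))‖ ≤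
        M * (((n + 2 : ℕ) : ℝ) ^ 2 * M ^ n * ‖a - b‖ ^ 2) := by
      rw [norm_mul]; exact mul_le_mul ha ih (norm_nonneg _) hM
    have h2 : ‖((n + 2 : ℕ) : ℂ) * b ^ (n + 1) * (a - b) ^ 2‖ ≤
        ((n + 2 : ℕ) : ℝ) * M ^ (n + 1) * ‖a - b‖ ^ 2 := by
      rw [norm_mul, norm_mul, norm_pow, norm_pow, Complex.norm_natCast]
      gcongr
    calc _ ≤ M * (((n + 2 : ℕ) : ℝ) ^ 2 * M ^ n * ‖a - b‖ ^ 2) +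
          ((n + 2 : ℕ) : ℝ) * M ^ (n + 1) * ‖a - b‖ ^ 2 := (norm_add_le _ _).trans (add_le_add h1 h2)
      _ = (((n + 2 : ℕ) : ℝ) ^ 2 + ((n + 2 : ℕ) : ℝ)) * M ^ (n + 1) * ‖a - b‖ ^ 2 := by ring
      _ ≤ ((n + 1 + 2 : ℕ) : ℝ) ^ 2 * M ^ (n + 1) * ‖a - b‖ ^ 2 := by
          have hδ : 0 ≤ M ^ (n + 1) * ‖a - b‖ ^ 2 := by positivity
          have hc : ((n + 2 : ℕ) : ℝ) ^ 2 + ((n + 2 : ℕ) : ℝ) ≤ ((n + 1 + 2 : ℕ) : ℝ) ^ 2 := by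
            push_cast; nlinarith
          calc _ = (((n + 2 : ℕ) : ℝ) ^ 2 + ((n + 2 : ℕ) : ℝ)) * (M ^ (n + 1) * ‖a - b‖ ^ 2) := by ring
            _ ≤ ((n + 1 + 2 : ℕ) : ℝ) ^ 2 * (M ^ (n + 1) * ‖a - b‖ ^ 2) :=
                mul_le_mul_of_nonneg_right hc hδ
            _ = _ := by ring

/-! ## Part B. The decomposition `p = aX^{n+2} + a₁X^{n+1} + ℓ₂` -/

/-- For `deg p = n + 2`: `p(z) = a z^{n+2} + a₁ z^{n+1} + ℓ₂(z)` with `a = lc(p)`,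
`a₁ = p_{n+1}` and `deg ℓ₂ ≤ n`, where `ℓ₂ = p.eraseLead - C a₁ X^{n+1}`. [folklore] -/
theorem eval_eq_lead_add_sublead_add (p : Polynomial ℂ) {n : ℕ} (hn : p.natDegree = n + 2) (z : ℂ) :
    p.eval z = p.leadingCoeff * z ^ (n + 2) + p.coeff (n + 1) * z ^ (n + 1) +
      (p.eraseLead - Polynomial.C (p.coeff (n + 1)) * Polynomial.X ^ (n + 1)).eval z := by
  rw [eval_eq_eraseLead_add, hn, Polynomial.eval_sub, Polynomial.eval_mul, Polynomial.eval_C,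
    Polynomial.eval_pow, Polynomial.eval_X]
  ring

/-- `deg (p.eraseLead - C p_{n+1} X^{n+1}) ≤ n` when `deg p = n + 2`. [folklore] -/
theorem natDegree_sublead_le (p : Polynomial ℂ) {n : ℕ} (hn : p.natDegree = n + 2) :
    (p.eraseLead - Polynomial.C (p.coeff (n + 1)) * Polynomial.X ^ (n + 1)).natDegree ≤ n := by
  have h1 : p.eraseLead.natDegree ≤ n + 1 := by
    have := Polynomial.eraseLead_natDegree_le p; omega
  have h2 : (Polynomial.C (p.coeff (n + 1)) * Polynomial.X ^ (n + 1) : Polynomial ℂ).natDegree ≤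
      n + 1 := Polynomial.natDegree_C_mul_X_pow_le _ _
  have h3 : (p.eraseLead - Polynomial.C (p.coeff (n + 1)) * Polynomial.X ^ (n + 1)).natDegree ≤
      n + 1 := (Polynomial.natDegree_sub_le _ _).trans (max_le h1 h2)
  have h4 : (p.eraseLead - Polynomial.C (p.coeff (n + 1)) * Polynomial.X ^ (n + 1)).coeff (n + 1) =
      0 := by
    rw [Polynomial.coeff_sub, Polynomial.coeff_C_mul, Polynomial.coeff_X_pow, if_pos rfl, mul_one,
      Polynomial.eraseLead_coeff_of_ne _ (by omega), sub_self]
  have := Polynomial.natDegree_le_pred h3 h4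
  simpa using this

/-! ## Part C. The pointwise estimate -/

/-- **Pointwise second-order estimate.**  `deg p = n + 2`, `Re(lc(p)·i^{n+2}) = 0`; at
`z = x + iy` with `y ≥ 1`, `|x| ≤ y`, the smallness `K 2^n (1+|x|)² ≤ (η/2) y` and
`η ≤ |(n+2)τ x + σ|`: `(η/(2L₀))·y/log(3+3y) ≤ |Re p(z)|/log(2 + ‖p(z)‖)`, with the explicit constants
`K = ‖a‖(n+2)² + ‖a₁‖(n+1) + Σ|ℓ₂ᵢ|`, `L₀ = max(log(2 + Σ|pᵢ|·2^{n+2}), 0) + n + 2`. (new) -/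
theorem strip_ratio_lower_bound (p : Polynomial ℂ) {n : ℕ} (hdn : p.natDegree = n + 2)
    (hre : (p.leadingCoeff * I ^ (n + 2)).re = 0) {η x y : ℝ} (hη : 0 < η) (hy1 : 1 ≤ y)
    (hxy : |x| ≤ y)
    (hsm : (‖p.leadingCoeff‖ * ((n + 2 : ℕ) : ℝ) ^ 2 + ‖p.coeff (n + 1)‖ * ((n + 1 : ℕ) : ℝ) +
        coeffNormSum (p.eraseLead - Polynomial.C (p.coeff (n + 1)) * Polynomial.X ^ (n + 1))) *
        2 ^ n * (1 + |x|) ^ 2 ≤ η / 2 * y)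
    (hT : η ≤ |((n + 2 : ℕ) : ℝ) * (p.leadingCoeff * I ^ (n + 1)).re * x +
        (p.coeff (n + 1) * I ^ (n + 1)).re|) :
    η / (2 * (max (Real.log (2 + coeffNormSum p * 2 ^ (n + 2))) 0 + (n + 2))) *
        (y / Real.log (3 + 3 * y)) ≤
      |(p.eval ((x : ℂ) + (y : ℂ) * I)).re| / Real.log (2 + ‖p.eval ((x : ℂ) + (y : ℂ) * I)‖) := by
  obtain ⟨a, ha_def⟩ : ∃ a : ℂ, a = p.leadingCoeff := ⟨_, rfl⟩
  obtain ⟨a₁, ha₁_def⟩ : ∃ a₁ : ℂ, a₁ = p.coeff (n + 1) := ⟨_, rfl⟩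
  rw [← ha_def] at hre hsm hT; rw [← ha₁_def] at hsm hT
  obtain ⟨ℓ₂, hℓ₂_def⟩ : ∃ ℓ₂ : Polynomial ℂ,
      ℓ₂ = p.eraseLead - Polynomial.C a₁ * Polynomial.X ^ (n + 1) := ⟨_, rfl⟩
  rw [← hℓ₂_def] at hsm
  have hℓ₂deg : ℓ₂.natDegree ≤ n := by rw [hℓ₂_def, ha₁_def]; exact natDegree_sublead_le p hdn
  obtain ⟨τ, hτ_def⟩ : ∃ τ : ℝ, τ = (a * I ^ (n + 1)).re := ⟨_, rfl⟩
  obtain ⟨σ, hσ_def⟩ : ∃ σ : ℝ, σ = (a₁ * I ^ (n + 1)).re := ⟨_, rfl⟩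
  rw [← hτ_def, ← hσ_def] at hT
  obtain ⟨C₂, hC₂⟩ : ∃ C₂ : ℝ, C₂ = coeffNormSum ℓ₂ := ⟨_, rfl⟩; rw [← hC₂] at hsm
  have hC₂0 : 0 ≤ C₂ := by rw [hC₂]; exact coeffNormSum_nonneg ℓ₂
  obtain ⟨Cp, hCp⟩ : ∃ Cp : ℝ, Cp = coeffNormSum p := ⟨_, rfl⟩; rw [← hCp]
  have hCp0 : 0 ≤ Cp := by rw [hCp]; exact coeffNormSum_nonneg p
  obtain ⟨K, hK⟩ : ∃ K : ℝ, K = ‖a‖ * ((n + 2 : ℕ) : ℝ) ^ 2 + ‖a₁‖ * ((n + 1 : ℕ) : ℝ) + C₂ :=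
    ⟨_, rfl⟩
  rw [← hK] at hsm
  have hK0 : 0 ≤ K := by rw [hK]; positivity
  obtain ⟨C', hC'⟩ : ∃ C' : ℝ, C' = Cp * 2 ^ (n + 2) := ⟨_, rfl⟩; rw [← hC']
  have hC'0 : 0 ≤ C' := by rw [hC']; positivity
  obtain ⟨L₀, hL₀⟩ : ∃ L₀ : ℝ, L₀ = max (Real.log (2 + C')) 0 + (n + 2) := ⟨_, rfl⟩; rw [← hL₀]
  have hL₀pos : 0 < L₀ := by have := le_max_right (Real.log (2 + C')) 0; rw [hL₀]; positivity
  have hy0 : 0 < y := by linarith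
  obtain ⟨z, hz_def⟩ : ∃ z : ℂ, z = (x : ℂ) + (y : ℂ) * I := ⟨_, rfl⟩; rw [← hz_def]
  obtain ⟨w, hw_def⟩ : ∃ w : ℂ, w = (y : ℂ) * I := ⟨_, rfl⟩
  have hzw : z - w = (x : ℂ) := by rw [hz_def, hw_def]; ring
  obtain ⟨M, hM_def⟩ : ∃ M : ℝ, M = |x| + y := ⟨_, rfl⟩
  have hx0 : 0 ≤ |x| := abs_nonneg x
  have hM1 : 1 ≤ M := by rw [hM_def]; linarith
  have hM0 : 0 ≤ M := by linarith
  have hwn : ‖w‖ = y := by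
    rw [hw_def, norm_mul, Complex.norm_real, Complex.norm_I, mul_one, Real.norm_eq_abs,
      abs_of_pos hy0]
  have hwM : ‖w‖ ≤ M := by rw [hwn, hM_def]; linarith
  have hzM : ‖z‖ ≤ M := by
    have h1 : ‖(x : ℂ)‖ = |x| := by rw [Complex.norm_real, Real.norm_eq_abs]
    calc ‖z‖ ≤ ‖(x : ℂ)‖ + ‖w‖ := by rw [hz_def, hw_def]; exact norm_add_le _ _
      _ = M := by rw [h1, hwn, hM_def]
  have hM2 : M ≤ 2 * y := by rw [hM_def]; linarith
  have hMn : M ^ n ≤ 2 ^ n * y ^ n := by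
    rw [← mul_pow]; exact pow_le_pow_left₀ hM0 hM2 n
  have hyn1 : 1 ≤ y ^ n := one_le_pow₀ hy1
  obtain ⟨R₂, hR₂⟩ : ∃ R₂ : ℂ,
      R₂ = z ^ (n + 2) - w ^ (n + 2) - ((n + 2 : ℕ) : ℂ) * w ^ (n + 1) * (z - w) := ⟨_, rfl⟩
  have hR₂n : ‖R₂‖ ≤ ((n + 2 : ℕ) : ℝ) ^ 2 * M ^ n * x ^ 2 := by
    have h := norm_pow_sub_pow_sub_mul_le hzM hwM n
    rw [← hR₂, hzw, Complex.norm_real, Real.norm_eq_abs, sq_abs] at h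
    exact h
  obtain ⟨R₁, hR₁⟩ : ∃ R₁ : ℂ, R₁ = z ^ (n + 1) - w ^ (n + 1) := ⟨_, rfl⟩
  have hR₁n : ‖R₁‖ ≤ ((n + 1 : ℕ) : ℝ) * M ^ n * |x| := by
    have h := norm_pow_sub_pow_le hzM hwM (n + 1)
    rw [← hR₁, hzw, Complex.norm_real, Real.norm_eq_abs, Nat.add_sub_cancel] at h
    exact h
  have hℓ₂n : ‖ℓ₂.eval z‖ ≤ C₂ * M ^ n := by
    rw [hC₂]; exact norm_eval_le_of_natDegree_le ℓ₂ hM1 hzM hℓ₂deg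
  have hwpow : ∀ m : ℕ, w ^ m = ((y ^ m : ℝ) : ℂ) * I ^ m := by
    intro m; rw [hw_def, mul_pow]; push_cast; ring
  have hmain0 : (a * w ^ (n + 2)).re = 0 := by
    rw [hwpow, show a * (((y ^ (n + 2) : ℝ) : ℂ) * I ^ (n + 2)) =
      ((y ^ (n + 2) : ℝ) : ℂ) * (a * I ^ (n + 2)) by ring, Complex.re_ofReal_mul, hre, mul_zero]
  have hmain1 : (((n + 2 : ℕ) : ℂ) * a * w ^ (n + 1) * (z - w)).re =
      ((n + 2 : ℕ) : ℝ) * τ * x * y ^ (n + 1) := by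
    rw [hzw, hwpow, show ((n + 2 : ℕ) : ℂ) * a * (((y ^ (n + 1) : ℝ) : ℂ) * I ^ (n + 1)) * (x : ℂ) =
      ((((n + 2 : ℕ) : ℝ) * x * y ^ (n + 1) : ℝ) : ℂ) * (a * I ^ (n + 1)) by push_cast; ring,
      Complex.re_ofReal_mul, hτ_def]
    ring
  have hmain2 : (a₁ * w ^ (n + 1)).re = σ * y ^ (n + 1) := by
    rw [hwpow, show a₁ * (((y ^ (n + 1) : ℝ) : ℂ) * I ^ (n + 1)) =
      ((y ^ (n + 1) : ℝ) : ℂ) * (a₁ * I ^ (n + 1)) by ring, Complex.re_ofReal_mul, hσ_def]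
    ring
  have hpz : p.eval z = a * w ^ (n + 2) + ((n + 2 : ℕ) : ℂ) * a * w ^ (n + 1) * (z - w) +
      a * R₂ + (a₁ * w ^ (n + 1) + a₁ * R₁) + ℓ₂.eval z := by
    rw [eval_eq_lead_add_sublead_add p hdn z, hR₂, hR₁, hℓ₂_def, ha₁_def, ha_def,
      Polynomial.eval_sub, Polynomial.eval_mul, Polynomial.eval_C, Polynomial.eval_pow,
      Polynomial.eval_X]
    ring
  have hRe : (p.eval z).re = (((n + 2 : ℕ) : ℝ) * τ * x + σ) * y ^ (n + 1) +
      ((a * R₂).re + (a₁ * R₁).re + (ℓ₂.eval z).re) := by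
    rw [hpz]
    simp only [Complex.add_re, hmain0, hmain1, hmain2]
    ring
  have hE : |(a * R₂).re + (a₁ * R₁).re + (ℓ₂.eval z).re| ≤ K * 2 ^ n * (1 + |x|) ^ 2 * y ^ n := by
    have e1 : |(a * R₂).re| ≤ ‖a‖ * (((n + 2 : ℕ) : ℝ) ^ 2 * M ^ n * x ^ 2) := by
      refine (abs_re_le_norm _).trans ?_
      rw [norm_mul]; exact mul_le_mul_of_nonneg_left hR₂n (norm_nonneg _)
    have e2 : |(a₁ * R₁).re| ≤ ‖a₁‖ * (((n + 1 : ℕ) : ℝ) * M ^ n * |x|) := by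
      refine (abs_re_le_norm _).trans ?_
      rw [norm_mul]; exact mul_le_mul_of_nonneg_left hR₁n (norm_nonneg _)
    have e3 : |(ℓ₂.eval z).re| ≤ C₂ * M ^ n := (abs_re_le_norm _).trans hℓ₂n
    have habs := abs_add_three ((a * R₂).re) ((a₁ * R₁).re) ((ℓ₂.eval z).re)
    have hX : 0 ≤ (1 + |x|) ^ 2 := by positivity
    have hsq : (1 + |x|) ^ 2 = 1 + 2 * |x| + |x| ^ 2 := by ring
    have hx2 : x ^ 2 ≤ (1 + |x|) ^ 2 := by
      rw [← sq_abs]; exact pow_le_pow_left₀ hx0 (by linarith) 2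
    have hxx : 0 ≤ |x| ^ 2 := by positivity
    have hx1 : |x| ≤ (1 + |x|) ^ 2 := by rw [hsq]; linarith
    have h11 : (1 : ℝ) ≤ (1 + |x|) ^ 2 := by rw [hsq]; linarith
    have hMn0 : 0 ≤ M ^ n := by positivity
    have f1 : ‖a‖ * (((n + 2 : ℕ) : ℝ) ^ 2 * M ^ n * x ^ 2) ≤
        ‖a‖ * ((n + 2 : ℕ) : ℝ) ^ 2 * M ^ n * (1 + |x|) ^ 2 := by
      rw [show ‖a‖ * (((n + 2 : ℕ) : ℝ) ^ 2 * M ^ n * x ^ 2) =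
        ‖a‖ * ((n + 2 : ℕ) : ℝ) ^ 2 * M ^ n * x ^ 2 by ring]
      exact mul_le_mul_of_nonneg_left hx2 (by positivity)
    have f2 : ‖a₁‖ * (((n + 1 : ℕ) : ℝ) * M ^ n * |x|) ≤
        ‖a₁‖ * ((n + 1 : ℕ) : ℝ) * M ^ n * (1 + |x|) ^ 2 := by
      rw [show ‖a₁‖ * (((n + 1 : ℕ) : ℝ) * M ^ n * |x|) = ‖a₁‖ * ((n + 1 : ℕ) : ℝ) * M ^ n * |x| by
        ring]
      exact mul_le_mul_of_nonneg_left hx1 (by positivity)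
    have f3 : C₂ * M ^ n ≤ C₂ * M ^ n * (1 + |x|) ^ 2 := by
      have := mul_le_mul_of_nonneg_left h11 (show 0 ≤ C₂ * M ^ n by positivity)
      rwa [mul_one] at this
    have f4 : K * M ^ n * (1 + |x|) ^ 2 ≤ K * (2 ^ n * y ^ n) * (1 + |x|) ^ 2 :=
      mul_le_mul_of_nonneg_right (mul_le_mul_of_nonneg_left hMn hK0) hX
    calc |(a * R₂).re + (a₁ * R₁).re + (ℓ₂.eval z).re|
        ≤ |(a * R₂).re| + |(a₁ * R₁).re| + |(ℓ₂.eval z).re| := habs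
      _ ≤ ‖a‖ * ((n + 2 : ℕ) : ℝ) ^ 2 * M ^ n * (1 + |x|) ^ 2 +
          ‖a₁‖ * ((n + 1 : ℕ) : ℝ) * M ^ n * (1 + |x|) ^ 2 + C₂ * M ^ n * (1 + |x|) ^ 2 := by
          linarith [e1.trans f1, e2.trans f2, e3.trans f3]
      _ = K * M ^ n * (1 + |x|) ^ 2 := by rw [hK]; ring
      _ ≤ K * (2 ^ n * y ^ n) * (1 + |x|) ^ 2 := f4
      _ = K * 2 ^ n * (1 + |x|) ^ 2 * y ^ n := by ring
  have hlow : η / 2 * y ^ (n + 1) ≤ |(p.eval z).re| := by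
    rw [hRe]
    have h1 : η * y ^ (n + 1) ≤ |(((n + 2 : ℕ) : ℝ) * τ * x + σ) * y ^ (n + 1)| := by
      rw [abs_mul, abs_of_nonneg (by positivity : (0 : ℝ) ≤ y ^ (n + 1))]
      exact mul_le_mul_of_nonneg_right hT (by positivity)
    have h2 : K * 2 ^ n * (1 + |x|) ^ 2 * y ^ n ≤ η / 2 * y ^ (n + 1) := by
      have := mul_le_mul_of_nonneg_right hsm (show (0 : ℝ) ≤ y ^ n by positivity)
      calc K * 2 ^ n * (1 + |x|) ^ 2 * y ^ n ≤ η / 2 * y * y ^ n := this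
        _ = η / 2 * y ^ (n + 1) := by ring
    have h3 := abs_add_le ((((n + 2 : ℕ) : ℝ) * τ * x + σ) * y ^ (n + 1) +
      ((a * R₂).re + (a₁ * R₁).re + (ℓ₂.eval z).re))
      (-((a * R₂).re + (a₁ * R₁).re + (ℓ₂.eval z).re))
    rw [add_neg_cancel_right, abs_neg] at h3
    linarith [hE]
  have hlogle : Real.log (2 + ‖p.eval z‖) ≤ L₀ * Real.log (3 + 3 * y) := by
    have hup : ‖p.eval z‖ ≤ C' * y ^ (n + 2) := by
      have h1 : ‖p.eval z‖ ≤ Cp * M ^ (n + 2) := by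
        rw [hCp]; exact norm_eval_le_of_natDegree_le p hM1 hzM hdn.le
      have h2 : M ^ (n + 2) ≤ 2 ^ (n + 2) * y ^ (n + 2) := by
        rw [← mul_pow]; exact pow_le_pow_left₀ hM0 hM2 _
      calc ‖p.eval z‖ ≤ Cp * M ^ (n + 2) := h1
        _ ≤ Cp * (2 ^ (n + 2) * y ^ (n + 2)) := mul_le_mul_of_nonneg_left h2 hCp0
        _ = C' * y ^ (n + 2) := by rw [hC']; ring
    have hlog3 := one_le_log_three_add y hy0.le
    have hlogn : Real.log y ≤ Real.log (3 + 3 * y) := Real.log_le_log hy0 (by linarith)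
    have hynd : 0 < y ^ (n + 2) := by positivity
    have hynd1 : (1 : ℝ) ≤ y ^ (n + 2) := one_le_pow₀ hy1
    calc Real.log (2 + ‖p.eval z‖) ≤ Real.log ((2 + C') * y ^ (n + 2)) := by
          refine Real.log_le_log (by positivity) ?_
          calc 2 + ‖p.eval z‖ ≤ 2 * y ^ (n + 2) + C' * y ^ (n + 2) := by linarith [hup]
            _ = (2 + C') * y ^ (n + 2) := by ring
      _ = Real.log (2 + C') + (n + 2) * Real.log y := by
          rw [Real.log_mul (by positivity) hynd.ne', Real.log_pow]; push_cast; ring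
      _ ≤ max (Real.log (2 + C')) 0 * Real.log (3 + 3 * y) + (n + 2) * Real.log (3 + 3 * y) := by
          refine add_le_add ?_ (mul_le_mul_of_nonneg_left hlogn (by positivity))
          calc Real.log (2 + C') ≤ max (Real.log (2 + C')) 0 := le_max_left _ _
            _ = max (Real.log (2 + C')) 0 * 1 := (mul_one _).symm
            _ ≤ max (Real.log (2 + C')) 0 * Real.log (3 + 3 * y) :=
                mul_le_mul_of_nonneg_left hlog3 (le_max_right _ _)
      _ = L₀ * Real.log (3 + 3 * y) := by rw [hL₀]; ring
  have hlogpos : 0 < Real.log (2 + ‖p.eval z‖) :=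
    Real.log_pos (by linarith [norm_nonneg (p.eval z)])
  have hlog3pos : 0 < Real.log (3 + 3 * y) := by linarith [one_le_log_three_add y hy0.le]
  have hyy : η / 2 * y ≤ η / 2 * y ^ (n + 1) := by
    refine mul_le_mul_of_nonneg_left ?_ (by positivity)
    calc y = y * 1 := (mul_one y).symm
      _ ≤ y * y ^ n := mul_le_mul_of_nonneg_left hyn1 hy0.le
      _ = y ^ (n + 1) := by ring
  rw [show η / (2 * L₀) * (y / Real.log (3 + 3 * y)) =
    (η / 2 * y) / (L₀ * Real.log (3 + 3 * y)) by field_simp]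
  exact div_le_div₀ (abs_nonneg _) (hyy.trans hlow) hlogpos hlogle

/-! ## Part D. The growth lemma -/

/-- **Second-order growth along a strip.**  `deg p = d ≥ 2`, `Re(lc(p)·i^d) = 0`,
`τ = Re(lc(p)·i^{d-1})`, `σ = Re(p_{d-1}·i^{d-1})`; `Im z_k → +∞`, `|Re z_k| ≤ A log(Im z_k) + B`,
and eventually `η ≤ |dτ Re z_k + σ|` with `η > 0`.  Then `|Re p(z_k)| / log(2 + ‖p(z_k)‖) → ∞`.
(new) -/
theorem tendsto_growth_eval_of_strip (p : Polynomial ℂ) (hd : 2 ≤ p.natDegree)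
    (hre : (p.leadingCoeff * I ^ p.natDegree).re = 0) {z : ℕ → ℂ}
    (hy : Tendsto (fun k => (z k).im) atTop atTop) {A B : ℝ} (hA : 0 ≤ A)
    (hx : ∀ᶠ k in atTop, |(z k).re| ≤ A * Real.log ((z k).im) + B) {η : ℝ} (hη : 0 < η)
    (hT : ∀ᶠ k in atTop, η ≤ |(p.natDegree : ℝ) * (p.leadingCoeff * I ^ (p.natDegree - 1)).re *
        (z k).re + (p.coeff (p.natDegree - 1) * I ^ (p.natDegree - 1)).re|) :
    Tendsto (fun k => |(p.eval (z k)).re| / Real.log (2 + ‖p.eval (z k)‖)) atTop atTop := by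
  obtain ⟨n, hdn⟩ : ∃ n : ℕ, p.natDegree = n + 2 := ⟨p.natDegree - 2, by omega⟩
  have hd1 : p.natDegree - 1 = n + 1 := by omega
  rw [hd1, hdn] at hT; rw [hdn] at hre
  obtain ⟨K, hK⟩ : ∃ K : ℝ, K = ‖p.leadingCoeff‖ * ((n + 2 : ℕ) : ℝ) ^ 2 +
      ‖p.coeff (n + 1)‖ * ((n + 1 : ℕ) : ℝ) +
      coeffNormSum (p.eraseLead - Polynomial.C (p.coeff (n + 1)) * Polynomial.X ^ (n + 1)) :=
    ⟨_, rfl⟩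
  have hK0 : 0 ≤ K := by
    rw [hK]
    have := coeffNormSum_nonneg (p.eraseLead - Polynomial.C (p.coeff (n + 1)) *
      Polynomial.X ^ (n + 1))
    positivity
  obtain ⟨L₀, hL₀⟩ : ∃ L₀ : ℝ, L₀ = max (Real.log (2 + coeffNormSum p * 2 ^ (n + 2))) 0 + (n + 2) :=
    ⟨_, rfl⟩
  have hL₀pos : 0 < L₀ := by
    have := le_max_right (Real.log (2 + coeffNormSum p * 2 ^ (n + 2))) 0; rw [hL₀]; positivity
  have hcmp : Tendsto (fun k => η / (2 * L₀) * ((z k).im / Real.log (3 + 3 * (z k).im))) atTop atTop :=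
    ((gce_tendsto_div_log_affine (by norm_num : (1 : ℝ) < 3) (by norm_num : (0 : ℝ) < 3)).comp
      hy).const_mul_atTop (by positivity)
  have hlog : ∀ ε : ℝ, 0 < ε → ∀ᶠ x : ℝ in atTop, Real.log x ≤ ε * x := by
    intro ε hε
    have h := Real.isLittleO_log_id_atTop.bound hε
    filter_upwards [h, eventually_ge_atTop (1 : ℝ)] with x hx hx1
    simp only [Real.norm_eq_abs, id] at hx
    rw [abs_of_nonneg (by linarith : (0 : ℝ) ≤ x)] at hx
    exact (le_abs_self _).trans hx
  have hlog2 : ∀ ε : ℝ, 0 < ε → ∀ᶠ x : ℝ in atTop, Real.log x ^ 2 ≤ ε * x := by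
    intro ε hε
    have h := (Real.isLittleO_pow_log_id_atTop (n := 2)).bound hε
    filter_upwards [h, eventually_ge_atTop (1 : ℝ)] with x hx hx1
    simp only [Real.norm_eq_abs, id] at hx
    rw [abs_of_nonneg (by positivity : (0 : ℝ) ≤ Real.log x ^ 2),
      abs_of_nonneg (by linarith : (0 : ℝ) ≤ x)] at hx
    exact hx
  have hside : ∀ᶠ k in atTop, 1 ≤ (z k).im ∧ |(z k).re| ≤ (z k).im ∧
      K * 2 ^ n * (1 + |(z k).re|) ^ 2 ≤ η / 2 * (z k).im := by
    have h0 : ∀ᶠ k in atTop, 1 ≤ (z k).im := hy.eventually_ge_atTop 1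
    have h1 := hy.eventually (hlog (1 / (2 * (A + 1))) (by positivity))
    have h2 : ∀ᶠ k in atTop, 2 * |B| ≤ (z k).im := hy.eventually_ge_atTop _
    have h3 := hy.eventually (hlog2 (η / (8 * (K * 2 ^ n * A ^ 2 + 1))) (by positivity))
    have h4 : ∀ᶠ k in atTop, 8 * K * 2 ^ n * (1 + |B|) ^ 2 / η ≤ (z k).im :=
      hy.eventually_ge_atTop _
    filter_upwards [h0, h1, h2, h3, h4, hx] with k hk0 hk1 hk2 hk3 hk4 hkx
    have hB := le_abs_self B
    have hlog0 : 0 ≤ Real.log ((z k).im) := Real.log_nonneg hk0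
    refine ⟨hk0, ?_, ?_⟩
    · have e1 : A * Real.log ((z k).im) ≤ (z k).im / 2 := by
        calc A * Real.log ((z k).im) ≤ A * (1 / (2 * (A + 1)) * (z k).im) :=
              mul_le_mul_of_nonneg_left hk1 hA
          _ = A / (A + 1) * ((z k).im / 2) := by field_simp
          _ ≤ 1 * ((z k).im / 2) := by
              refine mul_le_mul_of_nonneg_right ?_ (by linarith)
              rw [div_le_one (by linarith)]; linarith
          _ = (z k).im / 2 := one_mul _
      linarith
    · -- `(1 + |x|)² ≤ 2(1+|B|)² + 2A² log² y`
      have e0 : |(z k).re| ≤ A * Real.log ((z k).im) + |B| := hkx.trans (by linarith)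
      have e1 : (1 + |(z k).re|) ^ 2 ≤ 2 * (1 + |B|) ^ 2 + 2 * (A * Real.log ((z k).im)) ^ 2 := by
        have habs : 0 ≤ |(z k).re| := abs_nonneg _
        have hAl : 0 ≤ A * Real.log ((z k).im) := by positivity
        have hsq : (1 + |(z k).re|) ^ 2 ≤ (1 + |B| + A * Real.log ((z k).im)) ^ 2 :=
          pow_le_pow_left₀ (by positivity) (by linarith) 2
        nlinarith [sq_nonneg (1 + |B| - A * Real.log ((z k).im))]
      have e2 : K * 2 ^ n * (2 * (A * Real.log ((z k).im)) ^ 2) ≤ η / 4 * (z k).im := by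
        have h5 : K * 2 ^ n * A ^ 2 * Real.log ((z k).im) ^ 2 ≤
            K * 2 ^ n * A ^ 2 * (η / (8 * (K * 2 ^ n * A ^ 2 + 1)) * (z k).im) :=
          mul_le_mul_of_nonneg_left hk3 (by positivity)
        have e3 : K * 2 ^ n * A ^ 2 * (η / (8 * (K * 2 ^ n * A ^ 2 + 1)) * (z k).im) =
            (K * 2 ^ n * A ^ 2) / (K * 2 ^ n * A ^ 2 + 1) * (η / 8 * (z k).im) := by
          field_simp
        have e4 : (K * 2 ^ n * A ^ 2) / (K * 2 ^ n * A ^ 2 + 1) * (η / 8 * (z k).im) ≤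
            1 * (η / 8 * (z k).im) := by
          refine mul_le_mul_of_nonneg_right ?_ (by positivity)
          rw [div_le_one (by positivity)]; linarith
        have e34 : K * 2 ^ n * A ^ 2 * Real.log ((z k).im) ^ 2 ≤ η / 8 * (z k).im := by
          rw [e3] at h5; linarith [e4]
        calc K * 2 ^ n * (2 * (A * Real.log ((z k).im)) ^ 2)
            = 2 * (K * 2 ^ n * A ^ 2 * Real.log ((z k).im) ^ 2) := by ring
          _ ≤ 2 * (η / 8 * (z k).im) := by linarith [e34]
          _ = η / 4 * (z k).im := by ring
      have e5 : K * 2 ^ n * (2 * (1 + |B|) ^ 2) ≤ η / 4 * (z k).im := by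
        rw [div_le_iff₀ hη] at hk4
        calc K * 2 ^ n * (2 * (1 + |B|) ^ 2) = (8 * K * 2 ^ n * (1 + |B|) ^ 2) / 4 := by ring
          _ ≤ ((z k).im * η) / 4 := by linarith [hk4]
          _ = η / 4 * (z k).im := by ring
      calc K * 2 ^ n * (1 + |(z k).re|) ^ 2
          ≤ K * 2 ^ n * (2 * (1 + |B|) ^ 2 + 2 * (A * Real.log ((z k).im)) ^ 2) :=
            mul_le_mul_of_nonneg_left e1 (by positivity)
        _ = K * 2 ^ n * (2 * (1 + |B|) ^ 2) + K * 2 ^ n * (2 * (A * Real.log ((z k).im)) ^ 2) := by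
            ring
        _ ≤ η / 2 * (z k).im := by linarith [e2, e5]
  refine tendsto_atTop_mono' atTop ?_ hcmp
  filter_upwards [hside, hT] with k hk hkT
  have hz : z k = ((z k).re : ℂ) + ((z k).im : ℂ) * I := (Complex.re_add_im (z k)).symm
  have hsm := hk.2.2; rw [hK] at hsm
  have h := strip_ratio_lower_bound p hdn hre hη hk.1 hk.2.1 hsm hkT
  rw [← hL₀, ← hz] at h
  exact h

end Summit.Schanuel.Schanuel.Theorems
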